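import Literature.Analysis.FunctionSpaces.BMOProofs
import HarnessLib

/-!
# The Koch–Tataru space `BMO⁻¹`: finiteness of the `BMO⁻¹` norm

Topic `Analysis/FunctionSpaces`; proofs companion of
`Literature/Analysis/FunctionSpaces/BMO.lean` (section `BMOInv`), on top of
`Literature/Analysis/FunctionSpaces/BMOProofs.lean` (subadditivity of `‖·‖_*`). This file
discharges

* `Literature.Analysis.FunctionSpaces.MemBMOInv.eBMOInvNorm_lt_top` — a function in `BMO⁻¹` has finite `BMO⁻¹` norm
  (Koch–Tataru, *Well-posedness for the Navier–Stokes equations*, Adv. Math. 157 (2001), §1,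
  sentence before Theorem 1: "Clearly the divergence of a vector field with components in `BMO`
  is in `BMO⁻¹`", and §4, first paragraph of the proof of Theorem 1:
  `‖∇ · f‖²_{BMO⁻¹} ≤ C ∑ᵢ ‖fⁱ‖²_{BMO}`): `Literature.Analysis.FunctionSpaces.MemBMOInv.eBMOInvNorm_lt_top_holds`;
* `Literature.Analysis.FunctionSpaces.memBMOInv_iff_eBMOInvNorm_lt_top` — `u ∈ BMO⁻¹ ↔ ‖u‖_{BMO⁻¹} < ∞` (same source; `BMO⁻¹`
  is *defined* in §1 as the space of finite norm): `Literature.Analysis.FunctionSpaces.memBMOInv_iff_eBMOInvNorm_lt_top_holds`;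
* `Literature.Analysis.FunctionSpaces.memBMOInv_zero` — `0 ∈ BMO⁻¹` (same source, §1): `Literature.Analysis.FunctionSpaces.memBMOInv_zero_holds`;
* `Literature.Analysis.FunctionSpaces.MemBMOInv.add` — `BMO⁻¹` is stable under addition (same source, §1: a normed linear
  space): `Literature.Analysis.FunctionSpaces.MemBMOInv.add_holds`, via `Literature.Analysis.FunctionSpaces.HasWeakDivergenceRepresentation.add` (weak
  divergence representations add; the four integrands of the defining identity are integrable for
  a test function, `Literature.Analysis.FunctionSpaces.integrable_inner_of_locallyIntegrable_of_hasCompactSupport`) and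
  `Literature.Analysis.FunctionSpaces.MemBMO.add_holds`.

In this library `BMO⁻¹` is defined through the divergence representation `u = div Φ` with all
components `⟪Φ, v⟫ ∈ BMO` (`Literature.Analysis.FunctionSpaces.MemBMOInv`), and
`‖u‖_{BMO⁻¹} = inf_Φ sup_{‖v‖ ≤ 1} ‖⟪Φ, v⟫‖_*` (`Literature.Analysis.FunctionSpaces.eBMOInvNorm`, `Literature.Analysis.FunctionSpaces.eBMOSeminormVec`), so the
content of the first fact is the finite-dimensional statement
`(∀ v, ‖⟪Φ, v⟫‖_* < ∞) → sup_{‖v‖ ≤ 1} ‖⟪Φ, v⟫‖_* < ∞` (`Literature.Analysis.FunctionSpaces.eBMOSeminormVec_lt_top`).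

## Proof

`‖·‖_*` is subadditive on locally integrable functions (`Literature.Analysis.FunctionSpaces.eBMOSeminorm_add_le_holds`, iterated
to finite sums: `Literature.Analysis.FunctionSpaces.eBMOSeminorm_sum_le`) and absolutely homogeneous
(`Literature.Analysis.FunctionSpaces.eBMOSeminorm_const_smul_le`, `Literature.Analysis.FunctionSpaces.eBMOSeminorm_const_mul_le`: the Bochner ball averages
commute with scalars unconditionally, and `⨍⁻_B ‖c‖ₑ g = ‖c‖ₑ ⨍⁻_B g`). Expanding
`v = ∑ᵢ ⟪bᵢ, v⟫ bᵢ` in an orthonormal basis, `⟪Φ, v⟫ = ∑ᵢ ⟪bᵢ, v⟫ ⟪Φ, bᵢ⟫` with `|⟪bᵢ, v⟫| ≤ 1`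
for `‖v‖ ≤ 1`, whence `sup_{‖v‖ ≤ 1} ‖⟪Φ, v⟫‖_* ≤ ∑ᵢ ‖⟪Φ, bᵢ⟫‖_*`
(`Literature.Analysis.FunctionSpaces.eBMOSeminormVec_le_sum_orthonormalBasis`), a finite sum of finite quantities. For the
converse half of the `iff`, a representation with `sup_{‖v‖ ≤ 1} ‖⟪Φ, v⟫‖_* < ∞` has locally
integrable components (`Φ` is locally integrable by `Literature.Analysis.FunctionSpaces.HasWeakDivergenceRepresentation`) and
`‖⟪Φ, v⟫‖_* ≤ ‖v‖ sup_{‖w‖ ≤ 1} ‖⟪Φ, w⟫‖_*` by homogeneity (`v = ‖v‖ (v/‖v‖)` for `v ≠ 0`).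

## References

* H. Koch, D. Tataru, *Well-posedness for the Navier–Stokes equations*, Adv. Math. 157 (2001),
  22–35, doi:10.1006/aima.2000.1937, §1 (definition of `BMO⁻¹`, Theorem 1) and §4 (proof of
  Theorem 1). [KochTataruAdvMath2001] (held: `paper:doi-10-1006-aima-2000-1937`, pp. 3 and 10 of
  the held copy.)
* E. M. Stein, *Harmonic Analysis: Real-Variable Methods, Orthogonality, and Oscillatory
  Integrals*, Princeton Math. Series 43 (1993), Ch. IV §1.1 (`‖·‖_*` is a seminorm). [SteinHA1993]
-/

noncomputable section

open MeasureTheory Metric Filter Topology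
open scoped ENNReal NNReal RealInnerProductSpace

namespace Literature.Analysis.FunctionSpaces

section BMO

variable {X : Type*} [PseudoMetricSpace X] [MeasurableSpace X]
variable {F : Type*} [NormedAddCommGroup F] [NormedSpace ℝ F]

/-- The zero function has zero BMO seminorm, for every measure and without completeness of `F`
(the Bochner average of `0` is `0` in any case). [folklore] -/
@[simp]
theorem eBMOSeminorm_zero (μ : Measure X) : eBMOSeminorm (0 : X → F) μ = 0 := by
  simp [eBMOSeminorm, average_zero]

/-- **Homogeneity of the BMO seminorm** (inequality form): `‖c • f‖_* ≤ ‖c‖ₑ ‖f‖_*` for every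
scalar `c : ℝ`, every `f` and every measure (Stein, *Harmonic Analysis* IV.1.1: `‖·‖_*` is a
seminorm). No integrability or completeness hypothesis is needed: the Bochner ball averages
commute with scalars unconditionally (`MeasureTheory.integral_smul`). [cite: SteinHA1993, IV.1.1] -/
theorem eBMOSeminorm_const_smul_le (c : ℝ) (f : X → F) (μ : Measure X) :
    eBMOSeminorm (c • f) μ ≤ ‖c‖ₑ * eBMOSeminorm f μ := by
  refine iSup_le fun x => iSup₂_le fun r hr => ?_
  have havg : ⨍ z in ball x r, c • f z ∂μ = c • ⨍ z in ball x r, f z ∂μ := by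
    rw [setAverage_eq, setAverage_eq, integral_smul, smul_comm]
  simp only [Pi.smul_apply]
  rw [havg]
  calc ⨍⁻ y in ball x r, ‖c • f y - c • ⨍ z in ball x r, f z ∂μ‖ₑ ∂μ
      = ⨍⁻ y in ball x r, ‖c‖ₑ * ‖f y - ⨍ z in ball x r, f z ∂μ‖ₑ ∂μ := by
        simp only [← smul_sub, enorm_smul]
    _ = ‖c‖ₑ * ⨍⁻ y in ball x r, ‖f y - ⨍ z in ball x r, f z ∂μ‖ₑ ∂μ := by
        rw [setLAverage_eq, setLAverage_eq, lintegral_const_mul' _ _ enorm_ne_top,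
          mul_div_assoc]
    _ ≤ ‖c‖ₑ * eBMOSeminorm f μ := by
        gcongr
        exact laverage_oscillation_le_eBMOSeminorm f μ x hr

/-- **Homogeneity of the BMO seminorm**, real-valued case with `*` in place of `•`:
`‖c f‖_* ≤ ‖c‖ₑ ‖f‖_*` (Stein, *Harmonic Analysis* IV.1.1). Stated separately so that users with
products of real functions need no `•`/`*` conversion. [cite: SteinHA1993, IV.1.1] -/
theorem eBMOSeminorm_const_mul_le (c : ℝ) (f : X → ℝ) (μ : Measure X) :
    eBMOSeminorm (fun x => c * f x) μ ≤ ‖c‖ₑ * eBMOSeminorm f μ := by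
  refine iSup_le fun x => iSup₂_le fun r hr => ?_
  have havg : ⨍ z in ball x r, c * f z ∂μ = c * ⨍ z in ball x r, f z ∂μ := by
    rw [setAverage_eq, setAverage_eq, integral_const_mul, smul_eq_mul, smul_eq_mul, mul_left_comm]
  rw [havg]
  calc ⨍⁻ y in ball x r, ‖c * f y - c * ⨍ z in ball x r, f z ∂μ‖ₑ ∂μ
      = ⨍⁻ y in ball x r, ‖c‖ₑ * ‖f y - ⨍ z in ball x r, f z ∂μ‖ₑ ∂μ := by
        simp only [← mul_sub, enorm_mul]
    _ = ‖c‖ₑ * ⨍⁻ y in ball x r, ‖f y - ⨍ z in ball x r, f z ∂μ‖ₑ ∂μ := by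
        rw [setLAverage_eq, setLAverage_eq, lintegral_const_mul' _ _ enorm_ne_top,
          mul_div_assoc]
    _ ≤ ‖c‖ₑ * eBMOSeminorm f μ := by
        gcongr
        exact laverage_oscillation_le_eBMOSeminorm f μ x hr

/-- **Finite subadditivity of the BMO seminorm**: on a proper pseudo-metric measure space, for a
finite family of locally integrable functions, `‖∑ᵢ fᵢ‖_* ≤ ∑ᵢ ‖fᵢ‖_*` (Stein, *Harmonic
Analysis* IV.1.1; iterate `Literature.Analysis.FunctionSpaces.eBMOSeminorm_add_le_holds`). [cite: SteinHA1993, IV.1.1] -/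
theorem eBMOSeminorm_sum_le [ProperSpace X] {ι : Type*} {s : Finset ι} {f : ι → X → F}
    {μ : Measure X} (hf : ∀ i ∈ s, LocallyIntegrable (f i) μ) :
    eBMOSeminorm (∑ i ∈ s, f i) μ ≤ ∑ i ∈ s, eBMOSeminorm (f i) μ := by
  classical
  induction s using Finset.induction_on with
  | empty => simp
  | insert a s ha ih =>
    rw [Finset.sum_insert ha, Finset.sum_insert ha]
    have hs : ∀ i ∈ s, LocallyIntegrable (f i) μ := fun i hi => hf i (Finset.mem_insert_of_mem hi)
    exact (eBMOSeminorm_add_le_holds (hf a (Finset.mem_insert_self a s))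
      (locallyIntegrable_finsetSum' s hs)).trans (add_le_add le_rfl (ih hs))

/-- **Finite subadditivity of the BMO seminorm**, pointwise-sum form:
`‖fun x => ∑ᵢ fᵢ x‖_* ≤ ∑ᵢ ‖fᵢ‖_*` for locally integrable `fᵢ` on a proper space (Stein, *Harmonic
Analysis* IV.1.1). [cite: SteinHA1993, IV.1.1] -/
theorem eBMOSeminorm_sum_le' [ProperSpace X] {ι : Type*} {s : Finset ι} {f : ι → X → F}
    {μ : Measure X} (hf : ∀ i ∈ s, LocallyIntegrable (f i) μ) :
    eBMOSeminorm (fun x => ∑ i ∈ s, f i x) μ ≤ ∑ i ∈ s, eBMOSeminorm (f i) μ := by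
  rw [← Finset.sum_fn]
  exact eBMOSeminorm_sum_le hf

end BMO

section BMOInv

variable {E : Type*} [NormedAddCommGroup E] [InnerProductSpace ℝ E] [FiniteDimensional ℝ E]
  [MeasurableSpace E] [BorelSpace E]

/-- A vector field all of whose components `⟪Φ, v⟫` are in `BMO` has vector `BMO` seminorm
`sup_{‖v‖ ≤ 1} ‖⟪Φ, v⟫‖_*` bounded by the sum of the seminorms of its coordinates in any
orthonormal basis `(bᵢ)` (Koch–Tataru 2001, §4, first paragraph of the proof of Theorem 1:
the `BMO⁻¹` norm of `∇ · f` is controlled through the `n` components `fⁱ`). Expanding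
`v = ∑ᵢ ⟪bᵢ, v⟫ bᵢ` with `|⟪bᵢ, v⟫| ≤ 1`, subadditivity and homogeneity of `‖·‖_*` give the
bound. [cite: KochTataruAdvMath2001, Theorem 1] -/
theorem eBMOSeminormVec_le_sum_orthonormalBasis {ι : Type*} [Fintype ι]
    (b : OrthonormalBasis ι ℝ E) {Φ : E → E} (hΦ : ∀ v : E, MemBMO (fun x => ⟪Φ x, v⟫)) :
    eBMOSeminormVec Φ ≤ ∑ i, eBMOSeminorm (fun x => ⟪Φ x, b i⟫) := by
  refine iSup₂_le fun v hv => ?_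
  -- expand `v` in the orthonormal basis `b`
  have hrepr : (fun x => ⟪Φ x, v⟫) = fun x => ∑ i, ⟪b i, v⟫ * ⟪Φ x, b i⟫ := by
    ext x
    conv_lhs => rw [← b.sum_repr' v]
    simp only [inner_sum, real_inner_smul_right]
  -- the coefficients are at most `1` in absolute value
  have hcoef : ∀ i, ‖⟪b i, v⟫‖ₑ ≤ 1 := fun i => by
    rw [Real.enorm_eq_ofReal_abs, ENNReal.ofReal_le_one]
    calc |⟪b i, v⟫| ≤ ‖b i‖ * ‖v‖ := abs_real_inner_le_norm _ _
      _ ≤ 1 * 1 := by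
          gcongr
          exact (b.orthonormal.1 i).le
      _ = 1 := one_mul 1
  have hli : ∀ i, LocallyIntegrable (fun x => ⟪b i, v⟫ * ⟪Φ x, b i⟫) := fun i => by
    simpa only [Pi.smul_def, smul_eq_mul] using (hΦ (b i)).locallyIntegrable.smul ⟪b i, v⟫
  rw [hrepr]
  have h₁ : eBMOSeminorm (fun x => ∑ i, ⟪b i, v⟫ * ⟪Φ x, b i⟫) ≤
      ∑ i, eBMOSeminorm (fun x => ⟪b i, v⟫ * ⟪Φ x, b i⟫) :=
    eBMOSeminorm_sum_le' fun i _ => hli i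
  have h₂ : ∑ i, eBMOSeminorm (fun x => ⟪b i, v⟫ * ⟪Φ x, b i⟫) ≤
      ∑ i, ‖⟪b i, v⟫‖ₑ * eBMOSeminorm (fun x => ⟪Φ x, b i⟫) :=
    Finset.sum_le_sum fun i _ => eBMOSeminorm_const_mul_le _ _ _
  have h₃ : ∑ i, ‖⟪b i, v⟫‖ₑ * eBMOSeminorm (fun x => ⟪Φ x, b i⟫) ≤
      ∑ i, eBMOSeminorm (fun x => ⟪Φ x, b i⟫) :=
    Finset.sum_le_sum fun i _ => mul_le_of_le_one_left' (hcoef i)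
  exact h₁.trans (h₂.trans h₃)

/-- For a vector field with `BMO` components the vector `BMO` seminorm
`sup_{‖v‖ ≤ 1} ‖⟪Φ, v⟫‖_*` is finite (Koch–Tataru 2001, §4, proof of Theorem 1, first
paragraph), by `eBMOSeminormVec_le_sum_orthonormalBasis` in the standard orthonormal basis.
[cite: KochTataruAdvMath2001, Theorem 1] -/
theorem eBMOSeminormVec_lt_top {Φ : E → E} (hΦ : ∀ v : E, MemBMO (fun x => ⟪Φ x, v⟫)) :
    eBMOSeminormVec Φ < ∞ :=
  (eBMOSeminormVec_le_sum_orthonormalBasis (stdOrthonormalBasis ℝ E) hΦ).trans_lt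
    (ENNReal.sum_lt_top.2 fun _ _ => (hΦ _).eBMOSeminorm_lt_top)

/-- **A function in `BMO⁻¹` has finite `BMO⁻¹` norm** (discharge of the named fact
`Literature.Analysis.FunctionSpaces.MemBMOInv.eBMOInvNorm_lt_top`; Koch–Tataru, Adv. Math. 157 (2001), Theorem 1 with §1,
"Clearly the divergence of a vector field with components in `BMO` is in `BMO⁻¹`", quantified
in §4, first paragraph of the proof of Theorem 1: `‖∇ · f‖²_{BMO⁻¹} ≤ C ∑ᵢ ‖fⁱ‖²_{BMO}`). With the
divergence-form definitions of this library: if `u = div Φ` weakly with all `⟪Φ, v⟫ ∈ BMO`, then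
`‖u‖_{BMO⁻¹} ≤ sup_{‖v‖ ≤ 1} ‖⟪Φ, v⟫‖_* ≤ ∑ᵢ ‖⟪Φ, bᵢ⟫‖_* < ∞` for an orthonormal basis `(bᵢ)`.
[cite: KochTataruAdvMath2001, Theorem 1] -/
theorem MemBMOInv.eBMOInvNorm_lt_top_holds : MemBMOInv.eBMOInvNorm_lt_top (E := E) := by
  intro u hu
  obtain ⟨Φ, hΦ, hrep⟩ := hu
  calc eBMOInvNorm u ≤ eBMOSeminormVec Φ := iInf₂_le Φ hrep
    _ < ∞ := eBMOSeminormVec_lt_top hΦ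

/-- **`u ∈ BMO⁻¹` iff `‖u‖_{BMO⁻¹} < ∞`** (discharge of the named fact
`Literature.Analysis.FunctionSpaces.memBMOInv_iff_eBMOInvNorm_lt_top`; Koch–Tataru 2001, Theorem 1 and the definition of
`BMO⁻¹` as the space of finite norm, §1). The forward direction is
`MemBMOInv.eBMOInvNorm_lt_top_holds`. Conversely, a representation `u = div Φ` with
`sup_{‖v‖ ≤ 1} ‖⟪Φ, v⟫‖_* < ∞` has every component in `BMO`: `⟪Φ, v⟫` is locally integrable
because `Φ` is (part of `HasWeakDivergenceRepresentation`), and for `v ≠ 0`,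
`⟪Φ, v⟫ = ‖v‖ ⟪Φ, v/‖v‖⟫` has seminorm at most `‖v‖ sup_{‖w‖ ≤ 1} ‖⟪Φ, w⟫‖_*` by homogeneity.
[cite: KochTataruAdvMath2001, Theorem 1] -/
theorem memBMOInv_iff_eBMOInvNorm_lt_top_holds : memBMOInv_iff_eBMOInvNorm_lt_top (E := E) := by
  intro u
  refine ⟨fun hu => MemBMOInv.eBMOInvNorm_lt_top_holds hu, fun hu => ?_⟩
  obtain ⟨Φ, hΦ⟩ := iInf_lt_iff.1 hu
  obtain ⟨hrep, hfin⟩ := iInf_lt_iff.1 hΦ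
  refine ⟨Φ, fun v => ⟨?_, ?_⟩, hrep⟩
  · -- local integrability of the component `⟪Φ, v⟫`
    intro x
    obtain ⟨s, hs, hint⟩ := hrep.locallyIntegrable_field x
    exact ⟨s, hs, hint.inner_const v⟩
  · -- finiteness of the seminorm by homogeneity
    rcases eq_or_ne v 0 with rfl | hv
    · have h0 : (fun x => ⟪Φ x, (0 : E)⟫) = (0 : E → ℝ) := funext fun x => inner_zero_right _
      rw [h0, eBMOSeminorm_zero]
      exact ENNReal.zero_lt_top
    · -- normalise: `w = ‖v‖⁻¹ v` has norm `1` (an opaque name, no `set`, keeps unification cheap)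
      obtain ⟨w, hw_def⟩ : ∃ w : E, w = ‖v‖⁻¹ • v := ⟨_, rfl⟩
      have hw : ‖w‖ ≤ 1 := by
        rw [hw_def]
        exact (norm_smul_inv_norm hv).le
      have hvw : (fun x => ⟪Φ x, v⟫) = fun x => ‖v‖ * ⟪Φ x, w⟫ := by
        funext x
        rw [hw_def, real_inner_smul_right, ← mul_assoc, mul_inv_cancel₀ (norm_ne_zero_iff.2 hv),
          one_mul]
      rw [hvw]
      have h₁ : eBMOSeminorm (fun x => ‖v‖ * ⟪Φ x, w⟫) ≤
          ‖‖v‖‖ₑ * eBMOSeminorm (fun x => ⟪Φ x, w⟫) := eBMOSeminorm_const_mul_le _ _ _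
      have h₂ : eBMOSeminorm (fun x => ⟪Φ x, w⟫) ≤ eBMOSeminormVec Φ :=
        le_iSup_of_le w (le_iSup_of_le hw le_rfl)
      exact h₁.trans_lt (ENNReal.mul_lt_top enorm_lt_top (h₂.trans_lt hfin))

/-- **`0 ∈ BMO⁻¹`** (discharge of the named fact `Literature.Analysis.FunctionSpaces.memBMOInv_zero`; Koch–Tataru 2001, §1:
`BMO⁻¹` is a linear space): the zero field represents the zero function
(`hasWeakDivergenceRepresentation_zero`) and its components are the constant `0`, which is in
`BMO` with seminorm `0`. [cite: KochTataruAdvMath2001, §1] -/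
theorem memBMOInv_zero_holds : memBMOInv_zero (E := E) := by
  refine ⟨0, fun v => ?_, hasWeakDivergenceRepresentation_zero⟩
  have h0 : (fun x => ⟪(0 : E → E) x, v⟫) = (0 : E → ℝ) := funext fun x => inner_zero_left _
  rw [h0]
  exact ⟨locallyIntegrable_zero, by rw [eBMOSeminorm_zero]; exact ENNReal.zero_lt_top⟩


/-- Integrability of `⟪Φ, G⟫` for `Φ` locally integrable and `G` continuous with compact support:
`|⟪Φ, G⟫| ≤ ‖G‖ ‖Φ‖` and `‖G‖ Φ ∈ L¹`
(`MeasureTheory.LocallyIntegrable.integrable_smul_left_of_hasCompactSupport`). [folklore] -/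
theorem integrable_inner_of_locallyIntegrable_of_hasCompactSupport {Φ G : E → E}
    (hΦ : LocallyIntegrable Φ) (hG : Continuous G) (hGs : HasCompactSupport G) :
    Integrable fun x => ⟪Φ x, G x⟫ := by
  have h1 : Integrable fun x => ‖G x‖ • Φ x :=
    hΦ.integrable_smul_left_of_hasCompactSupport (continuous_norm.comp hG) hGs.norm
  refine h1.norm.mono' (hΦ.aestronglyMeasurable.inner hG.aestronglyMeasurable)
    (Eventually.of_forall fun x => ?_)
  rw [norm_smul, norm_norm, mul_comm]
  exact norm_inner_le_norm _ _

/-- Weak divergence representations add up: `u = div Φ`, `v = div Ψ` weakly imply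
`u + v = div (Φ + Ψ)` weakly (linearity of the distributional divergence: both sides of the
defining identity `∫ u φ = -∫ ⟪Φ, ∇φ⟫` are additive, all four integrands being integrable for a
test function `φ`). [folklore] -/
theorem HasWeakDivergenceRepresentation.add {u v : E → ℝ} {Φ Ψ : E → E}
    (hu : HasWeakDivergenceRepresentation u Φ) (hv : HasWeakDivergenceRepresentation v Ψ) :
    HasWeakDivergenceRepresentation (u + v) (Φ + Ψ) where
  locallyIntegrable := hu.locallyIntegrable.add hv.locallyIntegrable
  locallyIntegrable_field := hu.locallyIntegrable_field.add hv.locallyIntegrable_field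
  integral_mul_eq φ hφ := by
    have hφc : Continuous φ := hφ.contDiff.continuous
    have hgc : Continuous (gradient φ) :=
      (InnerProductSpace.toDual ℝ E).symm.continuous.comp (hφ.contDiff.continuous_fderiv (by simp))
    have hgs : HasCompactSupport (gradient φ) :=
      (hφ.hasCompactSupport.fderiv (𝕜 := ℝ)).comp_left
        (g := (InnerProductSpace.toDual ℝ E).symm) (map_zero _)
    have iu : Integrable fun x => u x * φ x :=
      hu.locallyIntegrable.integrable_smul_right_of_hasCompactSupport hφc hφ.hasCompactSupport
    have iv : Integrable fun x => v x * φ x :=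
      hv.locallyIntegrable.integrable_smul_right_of_hasCompactSupport hφc hφ.hasCompactSupport
    have iΦ := integrable_inner_of_locallyIntegrable_of_hasCompactSupport
      hu.locallyIntegrable_field hgc hgs
    have iΨ := integrable_inner_of_locallyIntegrable_of_hasCompactSupport
      hv.locallyIntegrable_field hgc hgs
    simp only [Pi.add_apply, add_mul, inner_add_left]
    rw [integral_add iu iv, integral_add iΦ iΨ, hu.integral_mul_eq φ hφ, hv.integral_mul_eq φ hφ,
      neg_add]

/-- **`BMO⁻¹` is stable under addition** (discharge of the named fact `Literature.Analysis.FunctionSpaces.MemBMOInv.add`;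
Koch–Tataru 2001, §1: `BMO⁻¹` is a normed linear space): representations add
(`HasWeakDivergenceRepresentation.add`) and the components `⟪Φ + Ψ, w⟫ = ⟪Φ, w⟫ + ⟪Ψ, w⟫` stay in
`BMO` by `Literature.Analysis.FunctionSpaces.MemBMO.add_holds`. [cite: KochTataruAdvMath2001, §1] -/
theorem MemBMOInv.add_holds : MemBMOInv.add (E := E) := by
  intro u v hu hv
  obtain ⟨Φ, hΦ, hrepΦ⟩ := hu
  obtain ⟨Ψ, hΨ, hrepΨ⟩ := hv
  refine ⟨Φ + Ψ, fun w => ?_, hrepΦ.add hrepΨ⟩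
  have h : (fun x => ⟪(Φ + Ψ) x, w⟫) = (fun x => ⟪Φ x, w⟫) + fun x => ⟪Ψ x, w⟫ := by
    funext x
    simp only [Pi.add_apply, inner_add_left]
  rw [h]
  exact MemBMO.add_holds (hΦ w) (hΨ w)

end BMOInv

end Literature.Analysis.FunctionSpaces
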